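import Summits.MatrixMultiplication.MatrixMultiplication.Theorems.SoloInformedCarrierKoszul
import Summits.MatrixMultiplication.MatrixMultiplication.Theorems.SoloInformedDoorWidth
import Literature.Computability.AlgebraicComplexity.DegenerationSpectralMonotone
import Literature.Computability.AlgebraicComplexity.LaserMethodTheorem
import Literature.Computability.AlgebraicComplexity.SchoenhageTauDischarge
import Literature.Computability.AlgebraicComplexity.KroneckerRank
import Literature.Computability.AlgebraicComplexity.TensorRestrictionRank

/-!
# The Jordan-class door is unconditional: `T_{1,1,Γ₂}` degenerates to `T_{skewcw,2}`

Solo deliverable (informed mode), closing the one conditional case of the carrier family of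
`SoloInformedCarrierFamily` / `SoloInformedCarrierKoszul`: among the congruence classes of
non-degenerate `c₀`-blocks `M` (`I`, `H(μ)`, `Γ₂`), the door `R̃(T_{1,1,M}) = 3 ⇒ ω = 2` was a tree
theorem for `I` (the tree's `CoppersmithWinogradValue`), `H(μ)` (`SoloInformedWeightedLaser`), and
only conditional on the named hypothesis `hBCS` for the Jordan-type class `Γ₂` (block
`−a₁b₂ + a₂b₁ + a₂b₂`), which no coordinate laser engine reaches.

* `gammaCarrier_degeneratesTo_skew`: the toric degeneration `A = B = diag(1, 1, ε)`,
  `C = diag(−1, ε, 1)` of order `1` takes `T_{1,1,Γ₂}` to `T_{1,1,J} = T_{skewcw,2}` (the term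
  `a₂b₂c₀` is the only one of `ε`-degree `2`).
* `asymptoticRank_le_of_algDegeneratesTo`: **asymptotic rank is monotone under degeneration**
  (`t ⊴ s ⇒ R̃(t) ≤ R̃(s)`; BCS (15.26) + Lemma 15.27: `t^{⊠N} ≤ s^{⊠N} ⊠ M_{Nh}`,
  `R(M_{Nh}) ≤ (Nh+1)²`, and polynomial factors are invisible to `N`-th roots). The tree had this
  only for universal spectral points (`IsUniversalSpectralPoint.mono_of_algDegeneratesTo`).
* Hence `R̃(T_{skewcw,2}) ≤ R̃(T_{1,1,Γ₂})`, the base-2 laser value bound and the door for `Γ₂`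
  (`laserBound_gammaCarrier`, `matrixMultiplication_of_asymptoticRank_gammaCarrier_le_three`)
  follow from the skew ones, with the same width (`R̃ ≤ 3.25 ⇒ ω < 2.37`); and
  `matrixMultiplication_of_classRepresentative_door`: for EVERY class representative
  `M ∈ {1, H(μ) (μ ≠ 0), Γ₂}` the door `R̃(T_{1,1,M}) ≤ 3 ⇒ ω = 2` is an unconditional theorem.
-/

noncomputable section

open scoped BigOperators Polynomial
open Polynomial
open Literature.Computability.AlgebraicComplexity

namespace Summit.MatrixMultiplication.MatrixMultiplication.Theorems.CarrierFamily

/-! ## Asymptotic rank is monotone under degeneration -/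

/-- `R̃(t)^{N+1} ≤ R(t^{⊠(N+1)})` (the `N`-th term of the infimum defining `R̃`).
[cite: ChristandlVranaZuiddam2023, §1.1] -/
theorem asymptoticRank_pow_succ_le_tensorRank_kroneckerPow {ι κ μ : Type} [Fintype ι] [Fintype κ]
    [Fintype μ] (t : ι → κ → μ → ℂ) (N : ℕ) :
    asymptoticRank t ^ (N + 1) ≤ tensorRank (kroneckerPow t (N + 1)) := by
  have hb : BddBelow (Set.range fun N : ℕ =>
      ((tensorRank (kroneckerPow t (N + 1)) : ℝ) ^ ((N : ℝ) + 1)⁻¹)) :=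
    ⟨0, by rintro _ ⟨N, rfl⟩; positivity⟩
  have h1 : asymptoticRank t ≤ (tensorRank (kroneckerPow t (N + 1)) : ℝ) ^ ((N : ℝ) + 1)⁻¹ := by
    unfold asymptoticRank
    exact ciInf_le hb N
  have hR : (0 : ℝ) ≤ tensorRank (kroneckerPow t (N + 1)) := Nat.cast_nonneg _
  calc asymptoticRank t ^ (N + 1)
      ≤ ((tensorRank (kroneckerPow t (N + 1)) : ℝ) ^ ((N : ℝ) + 1)⁻¹) ^ (N + 1) :=
        pow_le_pow_left₀ (asymptoticRank_nonneg t) h1 _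
    _ = tensorRank (kroneckerPow t (N + 1)) := by
        rw [← Real.rpow_natCast, ← Real.rpow_mul hR]
        have : ((N : ℝ) + 1)⁻¹ * ((N + 1 : ℕ) : ℝ) = 1 := by
          push_cast
          exact inv_mul_cancel₀ (by positivity)
        rw [this, Real.rpow_one]

/-- **`t ⊴_h s ⇒ R(t^{⊠N}) ≤ (Nh+1)² · R(s^{⊠N})`** (`t^{⊠N} ⊴_{Nh} s^{⊠N}`, so
`t^{⊠N} ≤ s^{⊠N} ⊠ M_{Nh}` with `R(M_{Nh}) ≤ (Nh+1)²`; BCS (15.25)–(15.26)).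
[cite: BurgisserClausenShokrollahi1997, (15.26)] -/
theorem tensorRank_kroneckerPow_le_of_isApproxRestriction {ι κ μ ι' κ' μ' : Type} [Fintype ι]
    [Fintype κ] [Fintype μ] [Fintype ι'] [Fintype κ'] [Fintype μ'] {h : ℕ} {s : ι → κ → μ → ℂ}
    {t : ι' → κ' → μ' → ℂ} {A : ι' → ι → ℂ[X]} {B : κ' → κ → ℂ[X]} {C : μ' → μ → ℂ[X]}
    (hd : IsApproxRestriction h s t A B C) (N : ℕ) :
    tensorRank (kroneckerPow t N) ≤ (N * h + 1) ^ 2 * tensorRank (kroneckerPow s N) := by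
  classical
  obtain ⟨AN, BN, CN, hN⟩ := hd.exists_kroneckerPow N
  have hres := hN.restrictsTo_kronecker_coeffTensor
  calc tensorRank (kroneckerPow t N)
      ≤ tensorRank (kroneckerTensor (kroneckerPow s N) (coeffTensor ℂ (N * h))) :=
        hres.tensorRank_le
    _ ≤ tensorRank (kroneckerPow s N) * tensorRank (coeffTensor ℂ (N * h)) := Blaser2013_lemma58 _ _
    _ ≤ tensorRank (kroneckerPow s N) * (N * h + 1) ^ 2 :=
        Nat.mul_le_mul_left _ (tensorRank_coeffTensor_le ℂ (N * h))
    _ = (N * h + 1) ^ 2 * tensorRank (kroneckerPow s N) := Nat.mul_comm _ _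

/-- **Asymptotic rank is monotone under degeneration**: `t ⊴ s ⇒ R̃(t) ≤ R̃(s)` (Strassen;
BCS Lemma 15.27 with (15.26): along `N = N₀ i`, `R̃(t)^N ≤ R(t^{⊠N}) ≤ (Nh+1)² R(s^{⊠N}) ≤
(Nh+1)² (R̃(s)+ε)^N`, and polynomial factors are invisible to `N`-th roots).
[cite: BurgisserClausenShokrollahi1997, Lemma 15.27] -/
theorem asymptoticRank_le_of_algDegeneratesTo {ι κ μ ι' κ' μ' : Type} [Fintype ι] [Fintype κ]
    [Fintype μ] [Fintype ι'] [Fintype κ'] [Fintype μ'] {s : ι → κ → μ → ℂ} {t : ι' → κ' → μ' → ℂ}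
    (hd : AlgDegeneratesTo s t) : asymptoticRank t ≤ asymptoticRank s := by
  classical
  obtain ⟨h, A, B, C, hABC⟩ := hd
  have ht0 : 0 ≤ asymptoticRank t := asymptoticRank_nonneg t
  have hs0 : 0 ≤ asymptoticRank s := asymptoticRank_nonneg s
  refine le_of_forall_pos_le_add fun ε hε => ?_
  obtain ⟨N₀, hN₀, hpow⟩ := exists_tensorRank_kroneckerPow_mul_le s hε
  set r : ℝ := asymptoticRank s + ε with hr
  have hr0 : 0 ≤ r := add_nonneg hs0 hε.le
  have hNh : (0 : ℝ) ≤ (N₀ : ℝ) * h := by positivity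
  have key : ∀ i : ℕ, (asymptoticRank t ^ N₀) ^ i ≤
      ((N₀ : ℝ) * h + 1) ^ 2 * ((i : ℝ) + 1) ^ 2 * (r ^ N₀) ^ i := by
    intro i
    rcases Nat.eq_zero_or_pos i with rfl | hi
    · simp only [pow_zero, Nat.cast_zero, zero_add, one_pow, mul_one]
      nlinarith
    · rw [← pow_mul, ← pow_mul]
      obtain ⟨m, hm⟩ := Nat.exists_eq_succ_of_ne_zero (Nat.pos_iff_ne_zero.1 (Nat.mul_pos hN₀ hi))
      have h1 : asymptoticRank t ^ (N₀ * i) ≤ tensorRank (kroneckerPow t (N₀ * i)) := by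
        rw [hm]
        exact asymptoticRank_pow_succ_le_tensorRank_kroneckerPow t m
      have h2 : (tensorRank (kroneckerPow t (N₀ * i)) : ℝ) ≤
          (((N₀ * i : ℕ) : ℝ) * h + 1) ^ 2 * tensorRank (kroneckerPow s (N₀ * i)) := by
        exact_mod_cast tensorRank_kroneckerPow_le_of_isApproxRestriction hABC (N₀ * i)
      have h4 : (((N₀ * i : ℕ) : ℝ) * h + 1) ^ 2 ≤ ((N₀ : ℝ) * h + 1) ^ 2 * ((i : ℝ) + 1) ^ 2 := by
        rw [← mul_pow]
        refine pow_le_pow_left₀ (by positivity) ?_ 2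
        have hi0 : (0 : ℝ) ≤ (i : ℝ) := Nat.cast_nonneg i
        push_cast
        nlinarith [mul_nonneg hNh hi0]
      have h5 : (0 : ℝ) ≤ (((N₀ * i : ℕ) : ℝ) * h + 1) ^ 2 := by positivity
      calc asymptoticRank t ^ (N₀ * i) ≤ tensorRank (kroneckerPow t (N₀ * i)) := h1
        _ ≤ (((N₀ * i : ℕ) : ℝ) * h + 1) ^ 2 * tensorRank (kroneckerPow s (N₀ * i)) := h2
        _ ≤ (((N₀ * i : ℕ) : ℝ) * h + 1) ^ 2 * r ^ (N₀ * i) :=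
            mul_le_mul_of_nonneg_left (hpow i) h5
        _ ≤ ((N₀ : ℝ) * h + 1) ^ 2 * ((i : ℝ) + 1) ^ 2 * r ^ (N₀ * i) :=
            mul_le_mul_of_nonneg_right h4 (pow_nonneg hr0 _)
  have hle := le_of_forall_pow_le_polynomial_mul_pow (asymptoticRank t ^ N₀) (r ^ N₀)
    (((N₀ : ℝ) * h + 1) ^ 2) 2 (pow_nonneg hr0 _) key
  exact le_of_pow_le_pow_left₀ (by omega) hr0 hle

/-! ## The toric degeneration `T_{1,1,Γ₂} ⊵ T_{1,1,J}` -/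

/-- `A(ε) = B(ε) = diag(1, 1, ε)`. [folklore] -/
def gammaDegA : Fin 3 → Fin 3 → ℂ[X] := fun a' a =>
  if a = a' then monomial (![0, 0, 1] a') 1 else 0

/-- `C(ε) = diag(−1, ε, 1)`. [folklore] -/
def gammaDegC : Fin 3 → Fin 3 → ℂ[X] := fun c' c =>
  if c = c' then monomial (![0, 1, 0] c') (![-1, 1, 1] c') else 0

/-- **`(A(ε), B(ε), C(ε)) · T_{1,1,Γ₂} = ε · T_{1,1,J} − ε² · a₂b₂c₀`**: an approximate
restriction of order `1`. [folklore] -/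
theorem isApproxRestriction_gamma_skew :
    IsApproxRestriction 1 (cwShapeTensor 1 1 gammaBlock) (cwShapeTensor 1 1 skewBlock)
      gammaDegA gammaDegA gammaDegC := by
  intro a' b' c' j hj
  interval_cases j <;> fin_cases a' <;> fin_cases b' <;> fin_cases c' <;>
    simp [gammaDegA, gammaDegC, cwShapeTensor, gammaBlock, skewBlock,
      Matrix.one_apply, Polynomial.coeff_monomial, Polynomial.monomial_mul_monomial]

/-- **`T_{1,1,Γ₂} ⊵ T_{1,1,J} = T_{skewcw,2}`.** [folklore] -/
theorem gammaCarrier_degeneratesTo_skew :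
    AlgDegeneratesTo (cwShapeTensor 1 1 gammaBlock) (cwShapeTensor 1 1 skewBlock) :=
  ⟨1, _, _, _, isApproxRestriction_gamma_skew⟩

/-- **`R̃(T_{skewcw,2}) ≤ R̃(T_{1,1,Γ₂})`.** [folklore] -/
theorem asymptoticRank_skewCarrier_le_gammaCarrier :
    asymptoticRank (cwShapeTensor 1 1 skewBlock) ≤ asymptoticRank (cwShapeTensor 1 1 gammaBlock) :=
  asymptoticRank_le_of_algDegeneratesTo gammaCarrier_degeneratesTo_skew

/-! ## The door and its width for the Jordan class -/

/-- **Base-2 laser value bound for `T_{1,1,Γ₂}`, unconditionally**: `R̃(T_{1,1,Γ₂}) < ρ ⇒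
ω ≤ log₂(4ρ³/27)` (through the skew carrier). [cite: ConnerGesmundoLandsbergVentura2022, §5] -/
theorem laserBound_gammaCarrier (ρ : ℝ) (hρ : asymptoticRank (cwShapeTensor 1 1 gammaBlock) < ρ) :
    omega ℂ ≤ Real.logb 2 (4 * ρ ^ 3 / 27) :=
  laserBound_skewCwTensor_one ρ (asymptoticRank_skewCarrier_le_gammaCarrier.trans_lt hρ)

/-- **The Jordan-class door, unconditional**: `R̃(T_{1,1,Γ₂}) ≤ 3 ⇒ ω = 2`.
[cite: ConnerGesmundoLandsbergVentura2022, §5] -/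
theorem matrixMultiplication_of_asymptoticRank_gammaCarrier_le_three
    (h : asymptoticRank (cwShapeTensor 1 1 gammaBlock) ≤ 3) : _root_.MatrixMultiplication :=
  matrixMultiplication_of_laserBound laserBound_gammaCarrier h

/-- Width of the Jordan-class door: `R̃(T_{1,1,Γ₂}) ≤ 3.25 ⇒ ω < 2.37`.
[cite: AlmanDuanVassilevskaWilliamsXuXuZhou2025, Theorem 1.1] -/
theorem omega_lt_of_asymptoticRank_gammaCarrier_le
    (h : asymptoticRank (cwShapeTensor 1 1 gammaBlock) ≤ 3.25) : omega ℂ < 2.37 := by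
  refine WeightedLaser.omega_lt_of_asymptoticRank_skewCwTensor_one_le ?_
  rw [← cwShapeTensor_one_one_skewBlock]
  exact asymptoticRank_skewCarrier_le_gammaCarrier.trans h

/-- **Every congruence class of non-degenerate `c₀`-blocks has an unconditional door**: for the
class representatives `M = 1` (Coppersmith–Winograd), `M = H(μ)`, `μ ≠ 0` (generic and skew), and
`M = Γ₂` (Jordan type), `R̃(T_{1,1,M}) ≤ 3 ⇒ ω = 2`. [cite: CoppersmithWinograd1990, §6] -/
theorem matrixMultiplication_of_classRepresentative_door {M : Matrix (Fin 3) (Fin 3) ℂ}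
    (hM : M = 1 ∨ (∃ μ : ℂ, μ ≠ 0 ∧ M = hBlock μ) ∨ M = gammaBlock)
    (h : asymptoticRank (cwShapeTensor 1 1 M) ≤ 3) : _root_.MatrixMultiplication := by
  rcases hM with rfl | ⟨μ, hμ, rfl⟩ | rfl
  · exact matrixMultiplication_of_laserBound laserBound_cwTensor_two h
  · rw [← hCarrier_eq_cwShapeTensor] at h
    exact WeightedLaser.matrixMultiplication_of_asymptoticRank_hCarrier_le_three hμ h
  · exact matrixMultiplication_of_asymptoticRank_gammaCarrier_le_three h

end Summit.MatrixMultiplication.MatrixMultiplication.Theorems.CarrierFamily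

end
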